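import Summits.Ventures.HSemireg.WedgeHankelRecurrenceGaussChebyshevUExample

/-!
# Venture HSemireg — **CLOSED-FORM TWO-BY-TWO BOUNDS FOR THE EXTREME ZEROS AND THE SPREAD**: for a positive recurrence and any pair of consecutive diagonal coefficients `a_i, a_{i+1}`
# (`i + 1 ≤ t`) with coupling `b_{i+1}`, the block polynomial `(X − a_i)(X − a_{i+1}) − b_{i+1}` has the zeros `c ∓ R`, `c = (a_i + a_{i+1})∕2`, `R = √(((a_i − a_{i+1})∕2)² + b_{i+1})`, and
# Cauchy's interlacing for the block (N356) gives `x_0 ≤ c − R`, `c + R ≤ x_t`; hence the SPREAD of the zeros of `q_{t+1}` is at least `2R ≥ 2√b_{i+1}` for every coupling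

HONEST FRAMING. Part of the Lean index of the computation cell `pub-hsemireg` (seat p10 gen 45, Sunday typer «UNIFORM-IN-n»).  Real polynomials and `Real.sqrt` only; no variety, no cohomology
theory, no sheaf, no Ext group and no semiregularity map is constructed here; nothing here says that HC / HC_CM / HC_AV holds; no Literature fact (unproved `Prop`) is declared or used.  Custodian
versions as in `WedgeHankelSiegelIdeal` (1/3).
SOURCES (cited).  B. N. Parlett, *The Symmetric Eigenvalue Problem* (1980) §10.1 (principal 2×2 submatrices bound the extreme eigenvalues); L. Mirsky, *The spread of a matrix*, Mathematika 3 (1956)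
127–130 (`spread ≥ 2 max_{i≠j} |a_{ij}|` for Hermitian matrices, and via 2×2 principal submatrices); M. E. H. Ismail, *Classical and Quantum Orthogonal Polynomials* (2005) §7.2.
PROOF TYPED HERE.  The block recurrence with coefficients `(a_{n+i}, b_{n+i})` (N360 `recurrence_of_coefficients`) has `Q_2 = (X − a_{i+1})(X − a_i) − b_{i+1} = (X − (c − R))(X − (c + R))`
(`R² = ((a_i − a_{i+1})∕2)² + b_{i+1}`); N356 `associated_block_interlace_lower ∕ _upper` with `r' = 1`.
DEDUP DISCLOSURE (`rg -n 'two_by_two|spread' Summits/Ventures/HSemireg/WedgeHankelRecurrenceGauss*`, 2026-09-03): N329 `top_zero_block_bound` (the polynomial form `b_{i+1} ≤ (x_t − a_i)(x_t − a_{i+1})`),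
N330 (Popoviciu ∕ Nagy spread bounds from the Newton sums); the closed forms and `spread ≥ 2√b_j` are new.  The 3 names below: 0 hits tree-wide.

WHAT IS IN THE TREE.  N356 `associated_block_interlace_lower`, `associated_block_interlace_upper`; N360 `recurrence_of_coefficients`.
THIS FILE (namespace `Summit.Ventures.HSemireg.Wedge.HankelOuter` continued; CHAINED on N360 (import only); 0 definitions):
* §1126 `two_by_two_block_zeros` (the block recurrence and its two zeros `c ∓ R` in product form), **`extreme_zeros_two_by_two_bounds`** (`x_0 ≤ c − R` and `c + R ≤ x_t`),
  **`zeros_spread_ge_two_sqrt_coupling`** (`2R ≤ x_t − x_0`, in particular `2√b_{i+1} ≤ x_t − x_0`).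
CAVEATS.  Positive recurrences, `t ≥ 1`.  Nothing Ext-side.  New names only.
-/

open Module Polynomial
open scoped Matrix Polynomial

namespace Summit.Ventures.HSemireg.Wedge.HankelOuter

/-! ## §1126. Two-by-two blocks: closed-form bounds -/

/-- **The `2 × 2` block at rows `i, i+1`**: a recurrence `Q` with coefficients `(a_{n+i}, b_{n+i})`, and `Q_2 = ∏_k (X − θ_k)` with `θ = (c − R, c + R)` increasing, `c = (a_i + a_{i+1})∕2`,
`R = √(((a_i − a_{i+1})∕2)² + b_{i+1}) > 0`. [this file, §1126] -/
theorem two_by_two_block_zeros (a b : ℕ → ℝ) (hb : ∀ j, 0 < b j) (i : ℕ) :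
    ∃ (Q : ℕ → ℝ[X]) (A B : ℕ → ℝ), Q 0 = 1 ∧ Q 1 = Polynomial.X - C (A 0) ∧ (∀ n, Q (n + 2) = (Polynomial.X - C (A (n + 1))) * Q (n + 1) - C (B (n + 1)) * Q n) ∧
      (∀ n, A n = a (n + i)) ∧ (∀ n, B n = b (n + i)) ∧
      StrictMono ![(a i + a (i + 1)) / 2 - Real.sqrt (((a i - a (i + 1)) / 2) ^ 2 + b (i + 1)), (a i + a (i + 1)) / 2 + Real.sqrt (((a i - a (i + 1)) / 2) ^ 2 + b (i + 1))] ∧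
      Q (1 + 1) = ∏ k : Fin (1 + 1), (Polynomial.X -
        C ((![(a i + a (i + 1)) / 2 - Real.sqrt (((a i - a (i + 1)) / 2) ^ 2 + b (i + 1)), (a i + a (i + 1)) / 2 + Real.sqrt (((a i - a (i + 1)) / 2) ^ 2 + b (i + 1))] : Fin 2 → ℝ) k)) := by
  obtain ⟨Q, hQ0, hQ1, hQrec⟩ := recurrence_of_coefficients (fun n => a (n + i)) (fun n => b (n + i))
  obtain ⟨R, hR⟩ : ∃ R : ℝ, R = Real.sqrt (((a i - a (i + 1)) / 2) ^ 2 + b (i + 1)) := ⟨_, rfl⟩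
  have hR0 : 0 < R := by rw [hR]; exact Real.sqrt_pos.2 (add_pos_of_nonneg_of_pos (sq_nonneg _) (hb (i + 1)))
  have hR2 : R ^ 2 = ((a i - a (i + 1)) / 2) ^ 2 + b (i + 1) := by rw [hR, Real.sq_sqrt (add_nonneg (sq_nonneg _) (hb (i + 1)).le)]
  rw [← hR]
  refine ⟨Q, fun n => a (n + i), fun n => b (n + i), hQ0, hQ1, hQrec, fun n => rfl, fun n => rfl, ?_, ?_⟩
  · refine Fin.strictMono_iff_lt_succ.2 fun k => ?_
    fin_cases k
    show (a i + a (i + 1)) / 2 - R < (a i + a (i + 1)) / 2 + R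
    linarith
  · rw [Fin.prod_univ_two]
    simp only [Matrix.cons_val_zero, Matrix.cons_val_one]
    rw [hQrec 0, hQ1, hQ0, mul_one, zero_add, zero_add]
    have hsum : C ((a i + a (i + 1)) / 2 - R) + C ((a i + a (i + 1)) / 2 + R) = C (a i) + C (a (1 + i)) := by
      rw [← C_add, ← C_add, show 1 + i = i + 1 by ring]; congr 1; ring
    have hprod : C ((a i + a (i + 1)) / 2 - R) * C ((a i + a (i + 1)) / 2 + R) = C (a i) * C (a (1 + i)) - C (b (1 + i)) := by
      rw [← C_mul, ← C_mul, ← C_sub, show 1 + i = i + 1 by ring]; congr 1; nlinarith [hR2]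
    linear_combination Polynomial.X * hsum - hprod

/-- **`x_0 ≤ c − R` and `c + R ≤ x_t`** for every pair of consecutive rows `i, i + 1 ≤ t` (`c = (a_i + a_{i+1})∕2`, `R = √(((a_i − a_{i+1})∕2)² + b_{i+1})`): the extreme zeros dominate the
eigenvalues of every `2 × 2` block. [Parlett §10.1; this file, §1126] -/
theorem extreme_zeros_two_by_two_bounds {q : ℕ → ℝ[X]} {a b : ℕ → ℝ} (hq0 : q 0 = 1) (hq1 : q 1 = Polynomial.X - C (a 0))
    (hrec : ∀ n, q (n + 2) = (Polynomial.X - C (a (n + 1))) * q (n + 1) - C (b (n + 1)) * q n) (hb : ∀ j, 0 < b j) {t i : ℕ} (hit : i + 1 ≤ t)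
    {x : Fin (t + 1) → ℝ} (hx : StrictMono x) (hxq : q (t + 1) = ∏ j, (Polynomial.X - C (x j))) :
    x 0 ≤ (a i + a (i + 1)) / 2 - Real.sqrt (((a i - a (i + 1)) / 2) ^ 2 + b (i + 1)) ∧ (a i + a (i + 1)) / 2 + Real.sqrt (((a i - a (i + 1)) / 2) ^ 2 + b (i + 1)) ≤ x (Fin.last t) := by
  obtain ⟨Q, A, B, hQ0, hQ1, hQrec, hA, hB, hθ, hθq⟩ := two_by_two_block_zeros a b hb i
  have h0 := associated_block_interlace_lower hq0 hq1 hrec hQ0 hQ1 hQrec hb hA hB (t := t) (r' := 1) hit hx hxq hθ hθq 0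
  have h1 := associated_block_interlace_upper hq0 hq1 hrec hQ0 hQ1 hQrec hb hA hB (t := t) (r' := 1) hit hx hxq hθ hθq 1
  simp only [Matrix.cons_val_zero, Matrix.cons_val_one, Fin.val_zero, Fin.val_one] at h0 h1
  refine ⟨le_of_eq_of_le (congrArg x (Fin.ext rfl)) h0, h1.trans_eq (congrArg x (Fin.ext (by simp; omega)))⟩

/-- **THE SPREAD IS AT LEAST TWICE EVERY COUPLING: `2√(((a_i − a_{i+1})∕2)² + b_{i+1}) ≤ x_t − x_0`, in particular `2√b_{i+1} ≤ x_t − x_0`** (`i + 1 ≤ t`). [Mirsky 1956; Parlett §10.1;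
this file, §1126] -/
theorem zeros_spread_ge_two_sqrt_coupling {q : ℕ → ℝ[X]} {a b : ℕ → ℝ} (hq0 : q 0 = 1) (hq1 : q 1 = Polynomial.X - C (a 0))
    (hrec : ∀ n, q (n + 2) = (Polynomial.X - C (a (n + 1))) * q (n + 1) - C (b (n + 1)) * q n) (hb : ∀ j, 0 < b j) {t i : ℕ} (hit : i + 1 ≤ t)
    {x : Fin (t + 1) → ℝ} (hx : StrictMono x) (hxq : q (t + 1) = ∏ j, (Polynomial.X - C (x j))) :
    2 * Real.sqrt (((a i - a (i + 1)) / 2) ^ 2 + b (i + 1)) ≤ x (Fin.last t) - x 0 ∧ 2 * Real.sqrt (b (i + 1)) ≤ x (Fin.last t) - x 0 := by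
  obtain ⟨h0, h1⟩ := extreme_zeros_two_by_two_bounds hq0 hq1 hrec hb hit hx hxq
  have hmono : Real.sqrt (b (i + 1)) ≤ Real.sqrt (((a i - a (i + 1)) / 2) ^ 2 + b (i + 1)) := Real.sqrt_le_sqrt (le_add_of_nonneg_left (sq_nonneg _))
  constructor <;> linarith

end Summit.Ventures.HSemireg.Wedge.HankelOuter
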